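import Literature.NumberTheory.Automorphic.HaarIntegralClosedCompactAverage
import Mathlib.MeasureTheory.Integral.RieszMarkovKakutani.Real
import Mathlib.MeasureTheory.Integral.Prod
import Mathlib.Topology.UrysohnsLemma
import HarnessLib

/-!
# Haar integral over `G = H K`: the `C_c` identity for all locally compact groups

Topic `NumberTheory/Automorphic`; namespace `Literature.NumberTheory.Automorphic.HaarHK`. The main step
of the proof of Deitmar–Echterhoff, *Principles of Harmonic Analysis* (2014), Prop. 1.5.6 in the
book's generality: for a locally compact Hausdorff group `G`, a closed subgroup `H`, a compact
subgroup `K` with `G = HK`, and *arbitrary* left Haar measures `μ_G, μ_H, μ_K` (Mathlib's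
`IsHaarMeasure`: no regularity, no countability), there is a constant `C > 0` with

`∫_G f dμ_G = C ∫_H ∫_K f(h k) dμ_K(k) dμ_H(h)` for every `f ∈ C_c(G, ℝ)`

(`exists_pos_integral_eq_mul_integral_integral_of_continuous`), together with the right-`K`-invariant
form `∫_G f dμ_G = c ∫_H f|_H dμ_H` (`exists_pos_integral_eq_mul_integral_of_mul_right_invariant`).
The second-countable case is `HaarHK.integral_eq_mul_integral_integral_of_compactlySupported`
(`HaarIntegralClosedCompactProofs.lean`, functional on `C_c(H × K)` and the product Haar measure);
the present argument avoids products altogether, which is what makes it work in general.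

**Proof.** `ψ ↦ ∫_G E ψ dμ_G`, where `E ψ (h k) = ∫_{H ∩ K} ψ(h l) dl` (`extendAvg`,
`HaarIntegralClosedCompactAverage.lean`), is a positive linear functional on `C_c(H, ℝ)`, invariant
under left `H`-translations; its Riesz–Markov measure (`RealRMK.rieszMeasure`) is a left-invariant
regular measure on `H`, hence `haarScalarFactor • μ_H` on `C_c(H)` by Haar uniqueness (which, for
`C_c` integrals, needs no regularity of `μ_H`); unwinding on right-`K`-invariant `f` (where
`E(f|_H) = haar(H ∩ K) f`) and `K`-averaging (`∫_G ∫_K f(gk) = μ_K(K) ∫_G f`, by the compact-support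
Fubini theorem and `Δ_G|_K = 1`) gives the identity. The passage to `L¹(μ_G)` for Radon Haar
measures is in `HaarIntegralClosedCompactRadonSets.lean` / `HaarIntegralClosedCompactRadon.lean`.

## References

* A. Deitmar, S. Echterhoff, *Principles of Harmonic Analysis*, 2nd ed., Universitext, Springer
  (2014), §1.5, Prop. 1.5.6 (p. 21), Thm. 1.5.3 (p. 19). [DeitmarEchterhoff2014]
-/

noncomputable section

open MeasureTheory Measure Set Topology CompactlySupported
open scoped ENNReal NNReal Pointwise

namespace Literature.NumberTheory.Automorphic.HaarHK

section Functional

variable {G : Type*} [Group G] [TopologicalSpace G] [IsTopologicalGroup G] [MeasurableSpace G]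
  [BorelSpace G] {H K : Subgroup G} [CompactSpace (K.subgroupOf H)]
  (hHK : ∀ g : G, ∃ h ∈ H, ∃ k ∈ K, g = h * k)
  [T2Space G] [LocallyCompactSpace G] (hH : IsClosed (H : Set G)) (hK : IsCompact (K : Set G))
  [LocallyCompactSpace H] [CompactSpace K]
  (μG : Measure G) [IsHaarMeasure μG] (μH : Measure H) [IsHaarMeasure μH]

include hH hK in
/-- **The heart of the proof of Prop. 1.5.6.** There is `c₁ > 0` with
`∫_G E ψ dμ_G = c₁ ∫_H ψ dμ_H` for every `ψ ∈ C_c(H, ℝ)`: `ψ ↦ ∫_G E ψ dμ_G` is a positive linear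
functional on `C_c(H, ℝ)`, represented (Riesz–Markov–Kakutani) by a regular measure on `H` which is
left invariant because `E` is `H`-equivariant and `μ_G` is left invariant (regular measures are
determined by their `C_c`-integrals); Haar uniqueness on `H` gives `c₁ = haarScalarFactor`, and
`c₁ > 0` by testing against `ψ₀ = 1` on `H ∩ K`. (This replaces the uniqueness of `H × K`-invariant
Radon measures on `(H × K)/(H ∩ K)`, Thm. 1.5.3 of the book, not available in Mathlib.)
[cite: DeitmarEchterhoff2014, proof of Prop. 1.5.6] -/
theorem exists_pos_integral_extendAvg_eq :
    ∃ c₁ : ℝ, 0 < c₁ ∧ ∀ ψ : C_c(H, ℝ), ∫ g, extendAvg hHK ψ g ∂μG = c₁ * ∫ x, ψ x ∂μH := by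
  have hint : ∀ ψ : C_c(H, ℝ), Integrable (extendAvg hHK ψ) μG := fun ψ =>
    (continuous_extendAvg hHK hH hK (map_continuous ψ)).integrable_of_hasCompactSupport
      (hasCompactSupport_extendAvg hHK ψ.hasCompactSupport)
  -- the positive linear functional `Λ ψ = ∫_G E ψ dμ_G`
  let Λ : C_c(H, ℝ) →ₚ[ℝ] ℝ := PositiveLinearMap.mk₀
    { toFun := fun ψ => ∫ g, extendAvg hHK ψ g ∂μG
      map_add' := fun ψ₁ ψ₂ => by
        simp only [CompactlySupportedContinuousMap.coe_add]
        rw [extendAvg_add hHK (map_continuous ψ₁) (map_continuous ψ₂)]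
        exact integral_add (hint ψ₁) (hint ψ₂)
      map_smul' := fun c ψ => by
        simp only [CompactlySupportedContinuousMap.coe_smul, RingHom.id_apply]
        rw [extendAvg_smul]
        exact integral_smul c _ }
    (fun ψ hψ => integral_nonneg fun g => extendAvg_nonneg hHK
      (fun x => by simpa using (CompactlySupportedContinuousMap.le_def.mp hψ) x) g)
  -- its Riesz–Markov measure
  let μ' : Measure H := RealRMK.rieszMeasure Λ
  have hμ' : ∀ ψ : C_c(H, ℝ), ∫ x, ψ x ∂μ' = ∫ g, extendAvg hHK ψ g ∂μG := fun ψ =>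
    RealRMK.integral_rieszMeasure Λ ψ
  haveI : μ'.Regular := RealRMK.regular_rieszMeasure Λ
  -- left invariance
  haveI : μ'.IsMulLeftInvariant := by
    refine ⟨fun h₀ => ?_⟩
    haveI : (map (fun x => h₀ * x) μ').Regular := Regular.map (Homeomorph.mulLeft h₀)
    apply Measure.ext_of_integral_eq_on_compactlySupported
    intro f
    let fh : C_c(H, ℝ) := ⟨⟨fun x => f (h₀ * x), (map_continuous f).comp (continuous_const_mul h₀)⟩,
      f.hasCompactSupport.comp_homeomorph (Homeomorph.mulLeft h₀)⟩
    calc ∫ x, f x ∂(map (fun x => h₀ * x) μ')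
          = ∫ x, f (h₀ * x) ∂μ' :=
            integral_map (measurable_const_mul h₀).aemeasurable
              (map_continuous f).aestronglyMeasurable
      _ = ∫ x, fh x ∂μ' := rfl
      _ = ∫ g, extendAvg hHK (fun x => f (h₀ * x)) g ∂μG := hμ' fh
      _ = ∫ g, extendAvg hHK f ((h₀ : G) * g) ∂μG := by simp_rw [extendAvg_comp_mul_left]
      _ = ∫ g, extendAvg hHK f g ∂μG := integral_mul_left_eq_self _ _
      _ = ∫ x, f x ∂μ' := (hμ' f).symm
  -- Haar uniqueness on `H`
  set c₁ : ℝ≥0 := haarScalarFactor μ' μH with hc₁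
  have hunique : ∀ ψ : C_c(H, ℝ), ∫ g, extendAvg hHK ψ g ∂μG = c₁ • ∫ x, ψ x ∂μH := fun ψ => by
    rw [← hμ' ψ, integral_isMulLeftInvariant_eq_smul_of_hasCompactSupport μ' μH (map_continuous ψ)
      ψ.hasCompactSupport, integral_smul_nnreal_measure]
  -- positivity of the constant
  have hpos : 0 < c₁ := by
    obtain ⟨f, hf1, hfc, -, hf01⟩ := exists_continuousMap_one_of_isCompact_subset_isOpen
      (isCompact_subgroupOf hH hK) isOpen_univ (subset_univ _)
    let ψ₀ : C_c(H, ℝ) := ⟨f, hfc⟩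
    have h1 : extendAvg hHK ψ₀ 1 = (haar : Measure (K.subgroupOf H)).real univ := by
      have : (1 : G) = ((1 : H) : G) * ((1 : K) : G) := by simp
      rw [this, extendAvg_mul]
      simp only [cosetAvg, one_mul]
      have hψ : ∀ l : K.subgroupOf H, ψ₀ (l : H) = 1 := fun l => hf1 l.2
      simp_rw [hψ, integral_const, smul_eq_mul, mul_one]
    have hpos' : 0 < ∫ g, extendAvg hHK ψ₀ g ∂μG := by
      refine Continuous.integral_pos_of_hasCompactSupport_nonneg_nonzero
        (continuous_extendAvg hHK hH hK (map_continuous ψ₀))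
        (hasCompactSupport_extendAvg hHK ψ₀.hasCompactSupport)
        (fun g => extendAvg_nonneg hHK (fun x => (hf01 x).1) g) (x := 1) ?_
      rw [h1]
      exact (haar_real_univ_subgroupOf_pos H K).ne'
    rw [hunique ψ₀] at hpos'
    by_contra hc
    rw [le_antisymm (not_lt.mp hc) bot_le, zero_smul] at hpos'
    exact lt_irrefl _ hpos'
  exact ⟨c₁, NNReal.coe_pos.mpr hpos, fun ψ => by rw [hunique ψ, NNReal.smul_def, smul_eq_mul]⟩

include hHK hH hK in
/-- **Prop. 1.5.6 for right-`K`-invariant integrands (`C_c` case).** There is `c > 0` such that for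
every `f ∈ C_c(G, ℝ)` with `f(gk) = f(g)` (`k ∈ K`): `∫_G f dμ_G = c ∫_H f(h) dμ_H`
(`c = c₁ / haar(H ∩ K)`). [cite: DeitmarEchterhoff2014, Prop. 1.5.6] -/
theorem exists_pos_integral_eq_mul_integral_restrict :
    ∃ c : ℝ, 0 < c ∧ ∀ f : G → ℝ, Continuous f → HasCompactSupport f →
      (∀ (g : G) (k : G), k ∈ K → f (g * k) = f g) →
        ∫ g, f g ∂μG = c * ∫ h : H, f h ∂μH := by
  obtain ⟨c₁, hc₁, h₁⟩ := exists_pos_integral_extendAvg_eq hHK hH hK μG μH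
  have hm := haar_real_univ_subgroupOf_pos H K
  refine ⟨c₁ / (haar : Measure (K.subgroupOf H)).real univ, div_pos hc₁ hm, fun f hf hcs hfK => ?_⟩
  let ψ : C_c(H, ℝ) := ⟨⟨fun h : H => f h, hf.comp continuous_subtype_val⟩,
    hcs.comp_isClosedEmbedding hH.isClosedEmbedding_subtypeVal⟩
  have e1 : ∫ g, extendAvg hHK ψ g ∂μG =
      (haar : Measure (K.subgroupOf H)).real univ * ∫ g, f g ∂μG := by
    have : (ψ : H → ℝ) = fun h : H => f h := rfl
    simp_rw [this, extendAvg_restrict_of_mul_right_invariant hHK hfK]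
    exact integral_const_mul _ _
  have e2 := h₁ ψ
  rw [e1] at e2
  rw [div_mul_eq_mul_div, eq_div_iff hm.ne', mul_comm, e2]
  rfl

end Functional

section KAverage

variable {G : Type*} [Group G] [TopologicalSpace G] [IsTopologicalGroup G] [MeasurableSpace G]
  [BorelSpace G] {K : Subgroup G} [CompactSpace K] (μK : Measure K) [IsHaarMeasure μK]

/-- The right `K`-average `T f (g) = ∫_K f(g k) dμ_K(k)` of a continuous `f` is continuous.
[folklore] -/
lemma continuous_integral_comp_mul_right {f : G → ℝ} (hf : Continuous f) :
    Continuous fun g : G => ∫ k : K, f (g * k) ∂μK := by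
  have hc : ContinuousOn (fun g : G => ∫ k : K, f (g * k) ∂μK) univ :=
    continuousOn_integral_of_compact_support (k := (univ : Set K)) isCompact_univ
      ((hf.comp (continuous_fst.mul (continuous_subtype_val.comp continuous_snd))).continuousOn)
      (fun p x _ hx => absurd (mem_univ x) hx)
  exact continuousOn_univ.mp hc

omit [IsTopologicalGroup G] [MeasurableSpace G] [BorelSpace G] [CompactSpace K] in
/-- Outside `(tsupport f) K⁻¹` all values `f (g k)`, `k ∈ K`, vanish. [folklore] -/
lemma apply_mul_eq_zero_of_not_mem {f : G → ℝ} {g : G}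
    (hg : g ∉ tsupport f * (K : Set G)⁻¹) (k : K) : f (g * k) = 0 := by
  by_contra hne
  exact hg ⟨g * k, subset_tsupport _ hne, (k : G)⁻¹, Set.inv_mem_inv.mpr k.2, by group⟩

omit [BorelSpace G] [CompactSpace K] [IsHaarMeasure μK] in
/-- `T f` has compact support, inside `(tsupport f) K⁻¹`. [folklore] -/
lemma hasCompactSupport_integral_comp_mul_right (hK : IsCompact (K : Set G)) {f : G → ℝ}
    (hcs : HasCompactSupport f) : HasCompactSupport fun g : G => ∫ k : K, f (g * k) ∂μK := by
  refine HasCompactSupport.intro (K := tsupport f * (K : Set G)⁻¹) (hcs.isCompact.mul hK.inv)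
    (fun g hg => ?_)
  simp [apply_mul_eq_zero_of_not_mem hg]

omit [CompactSpace K] in
/-- `T f` is right-`K`-invariant (left invariance of `μ_K`). [folklore] -/
lemma integral_comp_mul_right_mul (f : G → ℝ) (g : G) {k₀ : G} (hk₀ : k₀ ∈ K) :
    ∫ k : K, f (g * k₀ * k) ∂μK = ∫ k : K, f (g * k) ∂μK := by
  have : (fun k : K => f (g * k₀ * k)) = fun k => (fun k' : K => f (g * k')) (⟨k₀, hk₀⟩ * k) := by
    funext k
    simp only [Subgroup.coe_mul, mul_assoc]
  rw [this]
  exact integral_mul_left_eq_self (μ := μK) (fun k' : K => f (g * k')) (⟨k₀, hk₀⟩ : K)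

/-- `∫_G T f dμ_G = μ_K(K) ∫_G f dμ_G`: Fubini for compactly supported continuous functions and
right-`K`-invariance of `μ_G` (`Δ_G|_K = 1`). [folklore] -/
lemma integral_integral_comp_mul_right [T2Space G] [LocallyCompactSpace G]
    (hK : IsCompact (K : Set G)) (μG : Measure G) [IsHaarMeasure μG] {f : G → ℝ} (hf : Continuous f)
    (hcs : HasCompactSupport f) :
    ∫ g, ∫ k : K, f (g * k) ∂μK ∂μG = μK.real univ * ∫ g, f g ∂μG := by
  have hF : Continuous (Function.uncurry fun (g : G) (k : K) => f (g * k)) :=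
    hf.comp (continuous_fst.mul (continuous_subtype_val.comp continuous_snd))
  have hFc : HasCompactSupport (Function.uncurry fun (g : G) (k : K) => f (g * k)) := by
    refine HasCompactSupport.intro' (K := (tsupport f * (K : Set G)⁻¹) ×ˢ (univ : Set K))
      ((hcs.isCompact.mul hK.inv).prod isCompact_univ)
      (((hcs.isCompact.mul hK.inv).isClosed).prod isClosed_univ) ?_
    rintro ⟨g, k⟩ hgk
    have hg : g ∉ tsupport f * (K : Set G)⁻¹ := fun h => hgk ⟨h, mem_univ _⟩
    exact apply_mul_eq_zero_of_not_mem hg k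
  rw [integral_integral_swap_of_hasCompactSupport hF hFc]
  have : ∀ k : K, ∫ g, f (g * k) ∂μG = ∫ g, f g ∂μG := fun k =>
    integral_mul_right_eq_self_of_mem_compact μG hK k.2 hf hcs
  simp_rw [this, integral_const, smul_eq_mul]

end KAverage

section Main

variable {G : Type*} [Group G] [TopologicalSpace G] [IsTopologicalGroup G] [MeasurableSpace G]
  [BorelSpace G] [T2Space G] [LocallyCompactSpace G] {H K : Subgroup G}

/-- **Deitmar–Echterhoff Prop. 1.5.6 for `C_c` integrands — every locally compact group, every Haar
measure (in Mathlib's sense: left invariant, finite on compacts, positive on opens; no regularity or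
countability assumed).** For `H ≤ G` closed, `K ≤ G` compact with `G = HK` and left Haar measures
`μ_G, μ_H, μ_K` there is `C > 0` such that for every `f ∈ C_c(G, ℝ)`:
`∫_G f dμ_G = C ∫_H ∫_K f(h k) dμ_K(k) dμ_H(h)`. [cite: DeitmarEchterhoff2014, Prop. 1.5.6] -/
theorem exists_pos_integral_eq_mul_integral_integral_of_continuous (hH : IsClosed (H : Set G))
    (hK : IsCompact (K : Set G)) (hHK : ∀ g : G, ∃ h ∈ H, ∃ k ∈ K, g = h * k)
    (μG : Measure G) [IsHaarMeasure μG] (μH : Measure H) [IsHaarMeasure μH]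
    (μK : Measure K) [IsHaarMeasure μK] :
    ∃ C : ℝ, 0 < C ∧ ∀ f : G → ℝ, Continuous f → HasCompactSupport f →
      ∫ g, f g ∂μG = C * ∫ h : H, ∫ k : K, f ((h : G) * k) ∂μK ∂μH := by
  haveI : LocallyCompactSpace H := hH.isClosedEmbedding_subtypeVal.locallyCompactSpace
  haveI : CompactSpace K := isCompact_iff_compactSpace.mp hK
  haveI : CompactSpace (K.subgroupOf H) := isCompact_iff_compactSpace.mp (isCompact_subgroupOf hH hK)
  obtain ⟨c, hc, h⟩ := exists_pos_integral_eq_mul_integral_restrict hHK hH hK μG μH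
  have hmK : 0 < μK.real univ :=
    ENNReal.toReal_pos (isOpen_univ.measure_pos _ univ_nonempty).ne' (measure_lt_top _ _).ne
  refine ⟨c / μK.real univ, div_pos hc hmK, fun f hf hcs => ?_⟩
  have e1 := integral_integral_comp_mul_right μK hK μG hf hcs
  have e2 := h _ (continuous_integral_comp_mul_right μK hf)
    (hasCompactSupport_integral_comp_mul_right μK hK hcs)
    (fun g k hk => integral_comp_mul_right_mul μK f g hk)
  rw [e1] at e2
  rw [div_mul_eq_mul_div, eq_div_iff hmK.ne', mul_comm, e2]

/-- The right-`K`-invariant form, with the subtype instances discharged: for `H ≤ G` closed,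
`K ≤ G` compact, `G = HK` and Haar measures `μ_G, μ_H` there is `c > 0` with
`∫_G f dμ_G = c ∫_H f(h) dμ_H` for every right-`K`-invariant `f ∈ C_c(G, ℝ)`.
[cite: DeitmarEchterhoff2014, Prop. 1.5.6] -/
theorem exists_pos_integral_eq_mul_integral_of_mul_right_invariant (hH : IsClosed (H : Set G))
    (hK : IsCompact (K : Set G)) (hHK : ∀ g : G, ∃ h ∈ H, ∃ k ∈ K, g = h * k)
    (μG : Measure G) [IsHaarMeasure μG] (μH : Measure H) [IsHaarMeasure μH] :
    ∃ c : ℝ, 0 < c ∧ ∀ f : G → ℝ, Continuous f → HasCompactSupport f →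
      (∀ (g : G) (k : G), k ∈ K → f (g * k) = f g) →
        ∫ g, f g ∂μG = c * ∫ h : H, f h ∂μH := by
  haveI : LocallyCompactSpace H := hH.isClosedEmbedding_subtypeVal.locallyCompactSpace
  haveI : CompactSpace K := isCompact_iff_compactSpace.mp hK
  haveI : CompactSpace (K.subgroupOf H) := isCompact_iff_compactSpace.mp (isCompact_subgroupOf hH hK)
  exact exists_pos_integral_eq_mul_integral_restrict hHK hH hK μG μH

end Main

end Literature.NumberTheory.Automorphic.HaarHK
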